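import Summits.BirchSwinnertonDyer.BirchSwinnertonDyer.Theorems.ClassRecordThreeEulerHalvesAtThreeEichlerShimuraTorsionCountI
import Summits.BirchSwinnertonDyer.BirchSwinnertonDyer.Theorems.ClassRecordThreeEulerHalvesAtThreeEichlerShimuraSurjectiveCongruenceReduction
import Summits.BirchSwinnertonDyer.BirchSwinnertonDyer.Theorems.ClassRecordThreeEulerHalvesAtThreeEichlerShimuraLevelGamma1
import HarnessLib

/-!
# The torsion-refined Shapiro count over a field `K`, part J: TRANSPORT, and THE SPLIT HALF of (SIGᶜ-lift)(ii) is a THEOREM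

Helper file (route `ClassRecordThree`, crux `EulerHalvesAtThree`, print residue (SIGᶜ-lift)(ii); seat bsd-idea-10 g24, `--supports
stmt-BirchSwinnertonDyer-19109 --as helper`). Part I proved mod-`n` lifting of parabolic cochains at every finite-index level `Γ ∋ -1` of `SL(2, ℤ)`
(`modLift_level`). This file turns it into the SPLIT HALF of the named fact `Literature.NumberTheory.Automorphic.parabolicCochain_modLift` (the fact
itself is not asserted):

§1 Transport interface — `modLift_of_mulEquiv` (lifting transports along any group isomorphism `φ : Γ' ≃* Γ` matching the parabolicity predicates),
`modLift_clause_of_transport` (a TRANSPORT DATUM for `(B, O, ι)` — a finite-index `Γ ∋ -1` and `φ : ι(O¹) ≃* Γ` with `GL₂(ℝ)`-parabolic ↔ integral-parabolic —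
gives the `(B, O, ι)`-clause), `parabolicCochain_modLift_of_transport` ((transport data for split `B`) + (division clause) ⇒ the fact).

§2 The transport datum EXISTS for every split `(B, O, ι)` (`exists_transport_of_exists_not_isUnit`): the cell's split dictionary
`EichlerShimuraCongruence.exists_conj_normOneUnits_dictionary` (Wedderburn + Skolem–Noether + orders of `M₂(ℚ)` in conjugates of `M₂(ℤ)`; file
`…EichlerShimuraSurjectiveCongruenceReduction`) gives `h ∈ GL₂(ℝ)`, `N ≥ 1` with `ι(O¹) ⊆ h SL₂(ℤ) h⁻¹` and `h Γ(N) h⁻¹ ⊆ ι(O¹)`; so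
`Γ := {t ∈ SL₂(ℤ) | h t h⁻¹ ∈ ι(O¹)} ⊇ Γ(N)` is a finite-index level containing `-1`, `t ↦ h t h⁻¹` is an isomorphism `Γ ≅ ι(O¹)`, and parabolicity matches
(`Matrix.GeneralLinearGroup.isParabolic_conj_iff`, `isParabolic_mapGL_iff`). Hence

* `parabolicCochain_modLift_split` — **the `(B, O, ι)`-clause of `parabolicCochain_modLift` for EVERY quaternion algebra `B` over `ℚ` with a non-zero non-unit,
  every order `O`, every real embedding `ι`, every `n ≠ 0`** (sorry-free);
* `parabolicCochain_modLift_of_division` — (SIGᶜ-lift)(ii) follows from its DIVISION-ALGEBRA clause alone (compact Shimura curves: no parabolic elements;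
  closed-surface `H₁`; print), displayed inline as the hypothesis.
No summit statement is proved; nothing about any curve.

## References
* G. Shimura, *Introduction to the arithmetic theory of automorphic functions* (1971), §8.1–8.2, §9.2 p. 246 [ShimuraIATAF1971].
* M.-F. Vignéras, *Arithmétique des algèbres de quaternions*, LNM 800 (1980), Ch. IV §1 Thm. 1.1 [VignerasLNM800].
* J. Voight, *Quaternion algebras*, GTM 288 (2021), Main Thm. 7.7.1 (Skolem–Noether), 10.5.1–10.5.5 [Voight2021].
-/

noncomputable section

open scoped MatrixGroups ModularForm

open CongruenceSubgroup Matrix.SpecialLinearGroup ModularGroup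

set_option linter.dupNamespace false

namespace Summit.BirchSwinnertonDyer.BirchSwinnertonDyer.Theorems.EichlerShimuraLevelK

open _root_.Module _root_.LinearMap
open Literature.NumberTheory.EllipticCurves.ModularForms
open Literature.NumberTheory.Automorphic
open scoped Classical

variable {Γ : Subgroup SL(2, ℤ)}

/-! ## §1 Transport interface -/

/-! ### Transport along a group isomorphism -/

/-- **Mod-`n` lifting transports along a group isomorphism** `φ : Γ' ≃* Γ` onto a finite-index level `Γ ∋ -1` under which the predicate `P'`
corresponds to integral parabolicity (additivity, finite order and reductions are preserved by `φ`). [folklore] -/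
theorem modLift_of_mulEquiv {Γ' : Type*} [Group Γ'] [Γ.FiniteIndex] (hneg : (-1 : SL(2, ℤ)) ∈ Γ) (φ : Γ' ≃* Γ) (P' : Γ' → Prop)
    (hP : ∀ γ : Γ', P' γ ↔ (((φ γ : Γ) : SL(2, ℤ)) : Matrix (Fin 2) (Fin 2) ℤ).IsParabolic) (n : ℕ) (hn : n ≠ 0) (ψ : Γ' → ZMod n)
    (hadd : ∀ γ δ : Γ', ψ (γ * δ) = ψ γ + ψ δ) (htors : ∀ γ : Γ', IsOfFinOrder γ → ψ γ = 0) (hpar : ∀ γ : Γ', P' γ → ψ γ = 0) :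
    ∃ u : Γ' → ℤ, (∀ γ δ : Γ', u (γ * δ) = u γ + u δ) ∧ (∀ γ : Γ', P' γ → u γ = 0) ∧ ∀ γ : Γ', (u γ : ZMod n) = ψ γ := by
  obtain ⟨u', hu'add, hu'par, hu'red⟩ := modLift_level hneg n hn (ψ ∘ φ.symm)
    (fun γ δ ↦ by simp only [Function.comp_apply, map_mul, hadd])
    (fun γ hγ ↦ by
      simp only [Function.comp_apply]
      exact htors _ (φ.symm.toMonoidHom.isOfFinOrder hγ))
    (fun γ hγ ↦ by
      simp only [Function.comp_apply]
      exact hpar _ ((hP _).mpr (by simpa using hγ)))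
  refine ⟨u' ∘ φ, fun γ δ ↦ by simp only [Function.comp_apply, map_mul, hu'add], fun γ hγ ↦ hu'par _ ((hP γ).mp hγ), fun γ ↦ ?_⟩
  simp only [Function.comp_apply]
  rw [hu'red]
  simp

/-! ### The `(B, O, ι)`-clause from a transport datum -/

/-- **The `(B, O, ι)`-clause of `parabolicCochain_modLift` from a TRANSPORT DATUM**: an isomorphism `φ : ι(O¹) ≃* Γ` onto a finite-index
`Γ ∋ -1` of `SL(2, ℤ)` matching `GL₂(ℝ)`-parabolicity with integral parabolicity gives mod-`n` lifting for `ι(O¹)`, every `n ≠ 0`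
(`modLift_level`, part I). [cite: ShimuraIATAF1971, §8.2 (8.2.6), §9.2 p. 246] -/
theorem modLift_clause_of_transport {B : Type*} [Ring B] [Algebra ℚ B] (O : Submodule ℤ B) (hO : Brandt.IsOrder B O)
    (ι : B →ₐ[ℚ] Matrix (Fin 2) (Fin 2) ℝ) (Γ : Subgroup SL(2, ℤ)) [Γ.FiniteIndex] (hneg : (-1 : SL(2, ℤ)) ∈ Γ)
    (φ : normOneUnits ι hO ≃* Γ)
    (hφ : ∀ γ : normOneUnits ι hO, (γ : GL (Fin 2) ℝ).IsParabolic ↔ (((φ γ : Γ) : SL(2, ℤ)) : Matrix (Fin 2) (Fin 2) ℤ).IsParabolic)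
    (n : ℕ) (hn : n ≠ 0) (ψ : normOneUnits ι hO → ZMod n)
    (hadd : ∀ γ δ : normOneUnits ι hO, ψ (γ * δ) = ψ γ + ψ δ) (htors : ∀ γ : normOneUnits ι hO, IsOfFinOrder γ → ψ γ = 0)
    (hpar : ∀ γ : normOneUnits ι hO, (γ : GL (Fin 2) ℝ).IsParabolic → ψ γ = 0) :
    ∃ u : normOneUnits ι hO → ℤ, (∀ γ δ : normOneUnits ι hO, u (γ * δ) = u γ + u δ) ∧
      (∀ γ : normOneUnits ι hO, (γ : GL (Fin 2) ℝ).IsParabolic → u γ = 0) ∧ ∀ γ : normOneUnits ι hO, (u γ : ZMod n) = ψ γ :=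
  modLift_of_mulEquiv hneg φ (fun γ : normOneUnits ι hO ↦ (γ : GL (Fin 2) ℝ).IsParabolic) hφ n hn ψ hadd htors hpar

/-! ### (SIGᶜ-lift)(ii) from transport data for split algebras and the division-algebra clause -/

/-- **`parabolicCochain_modLift` ⇐ (transport data for SPLIT `B`) + (the clause for DIVISION `B`)**: the split half of (SIGᶜ-lift)(ii) is reduced
to pure algebra — for each `(B, O, ι)` with `B ∌` only units, an isomorphism of `ι(O¹)` onto a finite-index `Γ ∋ -1` of `SL(2, ℤ)` matching the
parabolicity predicates (Shimura §9.2: `B ≅ M₂(ℚ)`, `ι` conjugate to the inclusion, `O` in a conjugate of `M₂(ℤ)`); all counting is `modLift_level`.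
The division clause (compact quotient, no parabolics) is displayed verbatim as the second hypothesis. [cite: ShimuraIATAF1971, §8.2 (8.2.6), §9.2 p. 246]
[cite: VignerasLNM800, Ch. IV §1] -/
theorem parabolicCochain_modLift_of_transport
    (hsplit : ∀ (B : Type) [Ring B] [Algebra ℚ B] [IsQuaternionAlgebra ℚ B] (O : Submodule ℤ B) (hO : Brandt.IsOrder B O)
      (ι : B →ₐ[ℚ] Matrix (Fin 2) (Fin 2) ℝ), Function.Injective ι → (∃ x : B, x ≠ 0 ∧ ¬ IsUnit x) →
      ∃ (Γ : Subgroup SL(2, ℤ)) (_ : Γ.FiniteIndex) (_ : (-1 : SL(2, ℤ)) ∈ Γ) (φ : normOneUnits ι hO ≃* Γ),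
        ∀ γ : normOneUnits ι hO, (γ : GL (Fin 2) ℝ).IsParabolic ↔ (((φ γ : Γ) : SL(2, ℤ)) : Matrix (Fin 2) (Fin 2) ℤ).IsParabolic)
    (hdiv : ∀ (B : Type) [Ring B] [Algebra ℚ B] [IsQuaternionAlgebra ℚ B] (O : Submodule ℤ B) (hO : Brandt.IsOrder B O)
      (ι : B →ₐ[ℚ] Matrix (Fin 2) (Fin 2) ℝ), Function.Injective ι → (∀ x : B, x ≠ 0 → IsUnit x) →
      ∀ (n : ℕ), n ≠ 0 → ∀ ψ : normOneUnits ι hO → ZMod n,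
        (∀ γ δ : normOneUnits ι hO, ψ (γ * δ) = ψ γ + ψ δ) →
        (∀ γ : normOneUnits ι hO, IsOfFinOrder γ → ψ γ = 0) →
        (∀ γ : normOneUnits ι hO, (γ : GL (Fin 2) ℝ).IsParabolic → ψ γ = 0) →
        ∃ u : normOneUnits ι hO → ℤ,
          (∀ γ δ : normOneUnits ι hO, u (γ * δ) = u γ + u δ) ∧
          (∀ γ : normOneUnits ι hO, (γ : GL (Fin 2) ℝ).IsParabolic → u γ = 0) ∧
          ∀ γ : normOneUnits ι hO, (u γ : ZMod n) = ψ γ) :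
    parabolicCochain_modLift := by
  intro B _ _ _ O hO ι hι n hn ψ hadd htors hpar
  by_cases hs : ∃ x : B, x ≠ 0 ∧ ¬ IsUnit x
  · obtain ⟨Γ, hfi, hneg, φ, hφ⟩ := hsplit B O hO ι hι hs
    haveI := hfi
    exact modLift_clause_of_transport O hO ι Γ hneg φ hφ n hn ψ hadd htors hpar
  · exact hdiv B O hO ι hι (fun x hx ↦ by_contra fun hux ↦ hs ⟨x, hx, hux⟩) n hn ψ hadd htors hpar

/-! ## §2 The transport datum for split algebras -/

/-! ### Integral versus real parabolicity -/

/-- **Parabolicity is invariant under the integral cast**: `m.map (ℤ → ℝ)` is parabolic iff `m` is. [folklore] -/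
theorem isParabolic_map_intCast_iff {m : Matrix (Fin 2) (Fin 2) ℤ} : (m.map (Int.cast : ℤ → ℝ)).IsParabolic ↔ m.IsParabolic := by
  refine ⟨fun ⟨hs, hd⟩ ↦ ⟨?_, ?_⟩, EichlerShimuraLevel.isParabolic_map_intCast⟩
  · rw [EichlerShimuraLevel.mem_range_scalar_fin_two_iff] at hs ⊢
    simp only [Matrix.map_apply] at hs
    exact_mod_cast hs
  · rw [Matrix.discr_fin_two, Matrix.trace_fin_two, Matrix.det_fin_two] at hd ⊢
    simp only [Matrix.map_apply] at hd
    exact_mod_cast hd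

/-- `mapGL ℝ γ` is parabolic in `GL(2, ℝ)` iff `γ ∈ SL(2, ℤ)` is an integral parabolic matrix. [folklore] -/
theorem isParabolic_mapGL_iff (γ : SL(2, ℤ)) :
    Matrix.GeneralLinearGroup.IsParabolic (Matrix.SpecialLinearGroup.mapGL ℝ γ) ↔ (γ : Matrix (Fin 2) (Fin 2) ℤ).IsParabolic := by
  change ((Matrix.SpecialLinearGroup.mapGL ℝ γ : GL (Fin 2) ℝ) : Matrix (Fin 2) (Fin 2) ℝ).IsParabolic ↔ _
  rw [EichlerShimuraLevel.val_mapGL_eq_map, isParabolic_map_intCast_iff]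

/-! ### The conjugated embedding `t ↦ h t h⁻¹` and the level it cuts out -/

/-- The conjugated embedding `SL(2, ℤ) → GL(2, ℝ)`, `t ↦ h t h⁻¹`. [folklore] -/
def conjMapGL (h : GL (Fin 2) ℝ) : SL(2, ℤ) →* GL (Fin 2) ℝ :=
  (MulAut.conj h).toMonoidHom.comp (Matrix.SpecialLinearGroup.mapGL ℝ)

/-- `conjMapGL h t = h t h⁻¹`. [folklore] -/
theorem conjMapGL_apply (h : GL (Fin 2) ℝ) (t : SL(2, ℤ)) :
    conjMapGL h t = h * Matrix.SpecialLinearGroup.mapGL ℝ t * h⁻¹ := rfl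

/-- `t ↦ h t h⁻¹` is injective. [folklore] -/
theorem conjMapGL_injective (h : GL (Fin 2) ℝ) : Function.Injective (conjMapGL h) := fun _ _ hab ↦
  Matrix.SpecialLinearGroup.mapGL_injective ((MulAut.conj h).injective hab)

/-- `mapGL ℝ (-1) = -1`. [folklore] -/
theorem mapGL_neg_one : Matrix.SpecialLinearGroup.mapGL ℝ (-1 : SL(2, ℤ)) = -1 := by
  refine Units.ext ?_
  rw [EichlerShimuraLevel.val_mapGL_eq_map]
  ext i j
  fin_cases i <;> fin_cases j <;> simp

/-- `h (-1) h⁻¹ = -1`. [folklore] -/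
theorem conjMapGL_neg_one (h : GL (Fin 2) ℝ) : conjMapGL h (-1) = -1 := by
  rw [conjMapGL_apply, mapGL_neg_one]
  simp

section Split

variable {B : Type} [Ring B] [Algebra ℚ B] (O : Submodule ℤ B) (hO : Brandt.IsOrder B O) (ι : B →ₐ[ℚ] Matrix (Fin 2) (Fin 2) ℝ)

/-- `-1 ∈ ι(O¹)` (`-1 ∈ O`, `ι(-1) = -1`, `det(-1) = 1`). [folklore] -/
theorem neg_one_mem_normOneUnits : (-1 : GL (Fin 2) ℝ) ∈ normOneUnits ι hO := by
  refine ⟨⟨-1, O.neg_mem hO.one_mem, by simp⟩, ⟨-1, O.neg_mem hO.one_mem, by simp⟩, Units.ext ?_⟩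
  simp [Matrix.det_fin_two]

/-- **THE TRANSPORT DATUM FOR SPLIT `B`**: if `B` has a non-zero non-unit, `ι(O¹)` is isomorphic — by `γ ↦ h⁻¹ γ h` for the `h` of the split
dictionary — to a finite-index `Γ ∋ -1` of `SL(2, ℤ)` (namely `Γ = {t | h t h⁻¹ ∈ ι(O¹)} ⊇ Γ(N)`), with `GL₂(ℝ)`-parabolicity corresponding to
integral parabolicity. [cite: ShimuraIATAF1971, §9.2 p. 246] [cite: VignerasLNM800, Ch. IV §1 Thm. 1.1] -/
theorem exists_transport_of_exists_not_isUnit [IsQuaternionAlgebra ℚ B] (hsplit : ∃ x : B, x ≠ 0 ∧ ¬ IsUnit x) :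
    ∃ (Γ : Subgroup SL(2, ℤ)) (_ : Γ.FiniteIndex) (_ : (-1 : SL(2, ℤ)) ∈ Γ) (φ : normOneUnits ι hO ≃* Γ),
      ∀ γ : normOneUnits ι hO,
        (γ : GL (Fin 2) ℝ).IsParabolic ↔ (((φ γ : Γ) : SL(2, ℤ)) : Matrix (Fin 2) (Fin 2) ℤ).IsParabolic := by
  obtain ⟨h, N, -, hN, hsurj, hGamma⟩ := EichlerShimuraCongruence.exists_conj_normOneUnits_dictionary hO ι hsplit
  set Γ : Subgroup SL(2, ℤ) := (normOneUnits ι hO).comap (conjMapGL h) with hΓ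
  haveI : NeZero N := ⟨hN.ne'⟩
  have hle : CongruenceSubgroup.Gamma N ≤ Γ := fun s hs ↦ by
    rw [hΓ, Subgroup.mem_comap, conjMapGL_apply]
    exact hGamma N dvd_rfl s hs
  haveI : Γ.FiniteIndex := Subgroup.finiteIndex_of_le hle
  have hneg : (-1 : SL(2, ℤ)) ∈ Γ := by
    rw [hΓ, Subgroup.mem_comap, conjMapGL_neg_one]
    exact neg_one_mem_normOneUnits O hO ι
  let ψ₀ : Γ →* normOneUnits ι hO := (conjMapGL h).subgroupComap (normOneUnits ι hO)
  have hψ₀ : ∀ t : Γ, ((ψ₀ t : normOneUnits ι hO) : GL (Fin 2) ℝ) = conjMapGL h (t : SL(2, ℤ)) := fun t ↦ rfl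
  have hinj : Function.Injective ψ₀ := fun a b hab ↦ by
    apply Subtype.ext
    apply conjMapGL_injective h
    rw [← hψ₀, ← hψ₀, hab]
  have hsurj' : Function.Surjective ψ₀ := by
    rintro ⟨γ, hγ⟩
    obtain ⟨t, ht⟩ := hsurj γ hγ
    have htΓ : t ∈ Γ := by
      rw [hΓ, Subgroup.mem_comap, conjMapGL_apply, ← ht]
      exact hγ
    exact ⟨⟨t, htΓ⟩, Subtype.ext (by rw [hψ₀, conjMapGL_apply]; exact ht.symm)⟩
  set Φ : Γ ≃* normOneUnits ι hO := MulEquiv.ofBijective ψ₀ ⟨hinj, hsurj'⟩ with hΦ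
  refine ⟨Γ, inferInstance, hneg, Φ.symm, fun γ ↦ ?_⟩
  have hγ : (γ : GL (Fin 2) ℝ) = h * Matrix.SpecialLinearGroup.mapGL ℝ ((Φ.symm γ : Γ) : SL(2, ℤ)) * h⁻¹ := by
    rw [← conjMapGL_apply, ← hψ₀]
    exact congrArg (fun x : normOneUnits ι hO ↦ (x : GL (Fin 2) ℝ)) (Φ.apply_symm_apply γ).symm
  rw [hγ, Matrix.GeneralLinearGroup.isParabolic_conj_iff, isParabolic_mapGL_iff]

/-- **THE SPLIT HALF OF (SIGᶜ-lift)(ii) IS A THEOREM**: for every quaternion algebra `B` over `ℚ` with a non-zero non-unit, every order `O`,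
every real embedding `ι` and every `n ≠ 0`, every additive `ψ : ι(O¹) → ℤ/nℤ` killing the parabolic and the finite-order elements is the
reduction of an integral additive parabolic-null `u : ι(O¹) → ℤ` — the `(B, O, ι)`-clause of `parabolicCochain_modLift` verbatim (transport
datum + `modLift_level`, parts I–J; Shapiro count with torsion refinement, parts A–H). [cite: ShimuraIATAF1971, §8.1–8.2 (8.2.6), (8.2.24); §9.2 p. 246] -/
theorem parabolicCochain_modLift_split [IsQuaternionAlgebra ℚ B] (hsplit : ∃ x : B, x ≠ 0 ∧ ¬ IsUnit x) (n : ℕ) (hn : n ≠ 0)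
    (ψ : normOneUnits ι hO → ZMod n) (hadd : ∀ γ δ : normOneUnits ι hO, ψ (γ * δ) = ψ γ + ψ δ)
    (htors : ∀ γ : normOneUnits ι hO, IsOfFinOrder γ → ψ γ = 0)
    (hpar : ∀ γ : normOneUnits ι hO, (γ : GL (Fin 2) ℝ).IsParabolic → ψ γ = 0) :
    ∃ u : normOneUnits ι hO → ℤ, (∀ γ δ : normOneUnits ι hO, u (γ * δ) = u γ + u δ) ∧
      (∀ γ : normOneUnits ι hO, (γ : GL (Fin 2) ℝ).IsParabolic → u γ = 0) ∧ ∀ γ : normOneUnits ι hO, (u γ : ZMod n) = ψ γ := by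
  obtain ⟨Γ, hfi, hneg, φ, hφ⟩ := exists_transport_of_exists_not_isUnit O hO ι hsplit
  haveI := hfi
  exact modLift_clause_of_transport O hO ι Γ hneg φ hφ n hn ψ hadd htors hpar

end Split

/-- **(SIGᶜ-lift)(ii) ⇐ ITS DIVISION-ALGEBRA CLAUSE**: `parabolicCochain_modLift` follows from the same lifting statement for the `(B, O, ι)` with
`B` a DIVISION algebra (every non-zero element a unit: compact Shimura curves, no cusps) — the split half being `parabolicCochain_modLift_split`.
[cite: ShimuraIATAF1971, §8.2 (8.2.6), §9.2 p. 246] -/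
theorem parabolicCochain_modLift_of_division
    (hdiv : ∀ (B : Type) [Ring B] [Algebra ℚ B] [IsQuaternionAlgebra ℚ B] (O : Submodule ℤ B) (hO : Brandt.IsOrder B O)
      (ι : B →ₐ[ℚ] Matrix (Fin 2) (Fin 2) ℝ), Function.Injective ι → (∀ x : B, x ≠ 0 → IsUnit x) →
      ∀ (n : ℕ), n ≠ 0 → ∀ ψ : normOneUnits ι hO → ZMod n,
        (∀ γ δ : normOneUnits ι hO, ψ (γ * δ) = ψ γ + ψ δ) →
        (∀ γ : normOneUnits ι hO, IsOfFinOrder γ → ψ γ = 0) →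
        (∀ γ : normOneUnits ι hO, (γ : GL (Fin 2) ℝ).IsParabolic → ψ γ = 0) →
        ∃ u : normOneUnits ι hO → ℤ,
          (∀ γ δ : normOneUnits ι hO, u (γ * δ) = u γ + u δ) ∧
          (∀ γ : normOneUnits ι hO, (γ : GL (Fin 2) ℝ).IsParabolic → u γ = 0) ∧
          ∀ γ : normOneUnits ι hO, (u γ : ZMod n) = ψ γ) :
    parabolicCochain_modLift :=
  parabolicCochain_modLift_of_transport (fun _ _ _ _ O hO ι _ hs ↦ exists_transport_of_exists_not_isUnit O hO ι hs) hdiv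

end Summit.BirchSwinnertonDyer.BirchSwinnertonDyer.Theorems.EichlerShimuraLevelK

end
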